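import Mathlib
import Summits.NavierStokesRegularity.NavierStokesRegularity.Theorems.SubOnsagerCeilingKPSideBranchClassDynamics
import Summits.NavierStokesRegularity.NavierStokesRegularity.Theorems.OrthantWakeOrthantTableStructure
import HarnessLib

/-!
# TWO-MODE pump ladders: the Katz–Pavlović chain at scale ratio `(1+ε₀)^{1/2}` inside the KP class at ratio `1+ε₀`
(helper file for crux stmt-NavierStokesRegularity-27057 `SubOnsagerCeiling.ForwardTailCeilingKP`, `--supports … --as helper`;
companion of `SubOnsagerCeilingKPPumpLadder{,Witness,Chain}` (the four-mode ladder, ratio `(1+ε₀)^{1/4}`))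

THE TWO-LADDER CLASS (def-free hypotheses on a KP network proper `α`): ONE in-shell pump `0 → 1` (weight `P`) and ONE forward
feed `1 → 0` (weight `f`), Katz–Pavlović back-reactions, nothing else; components `2, 3` inert.  Closed forms
(`Λₙ = (1+ε₀)^{5n/2}`): `quadTerm₀(n) = fΛ_{n-1}x²_{1,n-1} − PΛₙx₀x₁`, `quadTerm₁(n) = PΛₙx₀² − fΛₙx_{1,n}x_{0,n+1}`,
`quadTerm₂ = quadTerm₃ = 0`: along the sites `m = 2n + j` this is the positive Katz–Pavlović chain with bond coefficients
`c_{2n} = PΛₙ`, `c_{2n+1} = fΛₙ` (`twoLadder_chain_step`); TUNED `f = P·(1+ε₀)^{5/4}` gives `c_m = P·B^{5m/2}`, `B = (1+ε₀)^{1/2}`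
(`twoLadder_tuned_coeff`).  GRADING LEMMA (`twoLadder_primary_zero_or_one`): in every grading with the stubs' structural clauses,
mode `0` or mode `1` is primary.  Hence (`twoLadder_chainBarrier_of_primaryGraded`) the body of `PrimaryGradedAt R ε₀ α` for a
two-ladder gives the ν-uniform super-critical barrier for the embedded chain at ratio `(1+ε₀)^{1/2}` on a residue class `mod 2`;
`twoLadder_nonempty`: the tuned two-ladder (`P = (1+ε₀)^{-5/4} ∈ [1/4, 1]`, `f = 1`) is a table of `E₂(8)`, orthant, diagonal
feeds, at every `ε₀ ∈ (0, 1]`.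

READING (with the four-ladder files): the registered LARGE-ratio stub `stub_primaryGradedLargeRatio` (`ε₀ ∈ (1/4, 1]`) contains the
λ-uniform chain barrier at every ratio in `((5/4)^{1/2}, 2^{1/2}] ≈ (1.118, 1.414]` (this file) `∪ ((5/4)^{1/4}, 2^{1/4}] ≈ (1.057, 1.189]`
(four-ladders) `∪ (5/4, 2]` (the chain itself) `= (1.057, 2]` — BY NAME.  HONEST FRAMING: MODEL lattice algebra/bookkeeping (rung
TL-M2Break); no stub, crux or summit is proved; nothing here bears on Navier–Stokes regularity.
[cite: Tao2016AveragedNS, §4 (4.2)–(4.3), (4.13)] [cite: BarbatoMorandinRomito2011, §3.2 (shape of the barrier)]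
-/

noncomputable section

-- the sub-problem namespace `NavierStokesRegularity.NavierStokesRegularity` is the tree's layout (D-0017)
set_option linter.dupNamespace false

namespace Summit.NavierStokesRegularity.NavierStokesRegularity.Theorems

open Set Finset
open Literature.Analysis.FluidPDE.TaoCascade

section TwoLadder

variable {α : Fin 4 → Fin 4 → Fin 4 → ℤ × ℤ × ℤ → ℝ} {P f : ℝ}

/-! ## §1 Closed-form dynamics -/

-- The in-shell table of a two-ladder is that of the side-branch class: `sideClass_inShell` (pump `0 → 1`).

/-- **Two-ladder sites**: `quadTerm₀(n) = fΛ_{n-1}x²_{1,n-1} − PΛₙx₀x₁`, `quadTerm₁(n) = PΛₙx₀² − fΛₙx_{1,n}x_{0,n+1}`,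
`quadTerm₂(n) = quadTerm₃(n) = 0` — with `c_{2n} = PΛₙ`, `c_{2n+1} = fΛₙ` this is the positive Katz–Pavlović chain
`ż_m = c_{m-1}z²_{m-1} − c_m z_m z_{m+1}` along the sites `m = 2n + j`. [this file] -/
theorem twoLadder_chain_step (hs : IsSymmetricCoeff α) (hc : IsCancellingCoeff α)
    (hO : ∀ (Y : Fin 4 → ℤ → ℝ → ℝ) (τ : ℝ), (∀ (j : Fin 4) (k : ℤ), 1 ≤ k → 0 ≤ Y j k τ) →
      ∀ δ : ℝ, 0 < δ → ∀ (i : Fin 4) (n : ℤ), 1 ≤ n → Y i n τ = 0 → 0 ≤ quadTerm δ α Y i n τ)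
    (hD : ∀ a b i : Fin 4, a ≠ b → α a b i (0, 0, 1) = 0)
    (hw : ∀ a c : Fin 4, α a a c (0, 0, 1) = if a = 1 ∧ c = 0 then f else 0)
    (hP : ∀ a c : Fin 4, a ≠ c → α a a c (0, 0, 0) = if a = 0 ∧ c = 1 then P else 0)
    (hCz : ∀ a b c : Fin 4, a ≠ b → a ≠ c → b ≠ c → α a b c (0, 0, 0) = 0)
    (ε₀ : ℝ) (X : Fin 4 → ℤ → ℝ → ℝ) (n : ℤ) (t : ℝ) (c : ℤ → ℝ)
    (hc0 : ∀ k : ℤ, c (2 * k) = P * (1 + ε₀) ^ ((5 : ℝ) * k / 2))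
    (hc1 : ∀ k : ℤ, c (2 * k + 1) = f * (1 + ε₀) ^ ((5 : ℝ) * k / 2)) :
    quadTerm ε₀ α X 0 n t = c (2 * (n - 1) + 1) * X 1 (n - 1) t ^ 2 - c (2 * n) * (X 0 n t * X 1 n t) ∧
    quadTerm ε₀ α X 1 n t = c (2 * n) * X 0 n t ^ 2 - c (2 * n + 1) * (X 1 n t * X 0 (n + 1) t) ∧
    quadTerm ε₀ α X 2 n t = 0 ∧ quadTerm ε₀ α X 3 n t = 0 := by
  refine ⟨?_, ?_, ?_, ?_⟩
  · rw [kpProper_quadTerm hs hc hO hD, sideClass_inShell hs hc hP hCz (fun j => X j n t) 0, hc1, hc0]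
    simp [hw]
    ring_nf
  · rw [kpProper_quadTerm hs hc hO hD, sideClass_inShell hs hc hP hCz (fun j => X j n t) 1, hc0, hc1]
    simp [hw]
    ring
  · rw [kpProper_quadTerm hs hc hO hD, sideClass_inShell hs hc hP hCz (fun j => X j n t) 2]
    simp [hw]
  · rw [kpProper_quadTerm hs hc hO hD, sideClass_inShell hs hc hP hCz (fun j => X j n t) 3]
    simp [hw]

/-- **The tuned two-ladder is the geometric chain at ratio `B = (1+ε₀)^{1/2}`**: with `f = P·(1+ε₀)^{5/4}` the bond
coefficient of site `m = 2n + j` is `P·(1+ε₀)^{5j/4}·Λₙ = P·B^{5m/2}`. [this file] -/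
theorem twoLadder_tuned_coeff {ε₀ : ℝ} (hε : -1 < ε₀) (c₀ : ℝ) (j : ℕ) (n : ℤ) :
    c₀ * (1 + ε₀) ^ ((5 : ℝ) * j / 4) * (1 + ε₀) ^ ((5 : ℝ) * n / 2) =
      c₀ * ((1 + ε₀) ^ ((1 : ℝ) / 2)) ^ ((5 : ℝ) * ((2 * n + j : ℤ) : ℝ) / 2) := by
  have hb : (0 : ℝ) < 1 + ε₀ := by linarith
  rw [← Real.rpow_mul hb.le, mul_assoc, ← Real.rpow_add hb]
  congr 1
  congr 1
  push_cast
  ring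

/-! ## §2 The grading lemma and the barrier -/

/-- **In every structural grading of a two-ladder, mode `0` or mode `1` is primary**: `1` is the only forward source
(`α 1 1 0 (0,0,1) = f ≠ 0`); if `lev 1 ≠ 0` its in-shell pump partner `0` (`α 0 0 1 (0,0,0) = P ≠ 0`, not a source) must
have level `0`. [this file] -/
theorem twoLadder_primary_zero_or_one
    (hw : ∀ a c : Fin 4, α a a c (0, 0, 1) = if a = 1 ∧ c = 0 then f else 0)
    (hP : ∀ a c : Fin 4, a ≠ c → α a a c (0, 0, 0) = if a = 0 ∧ c = 1 then P else 0)
    (hf : f ≠ 0) (hP0 : P ≠ 0) (lev : Fin 4 → ℕ)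
    (hstruct : ∀ a, lev a ≠ 0 → (∃ e, α a a e (0, 0, 1) ≠ 0) →
      (∀ j, α j j a (0, 0, 1) ≠ 0 → lev j < lev a ∧ (lev j = 0 ∨ ∃ e', α j j e' (0, 0, 1) ≠ 0)) ∧
      (∀ i₁ i₂, i₁ ≠ a → i₂ ≠ a → α i₁ i₂ a (0, 0, 0) ≠ 0 →
        (lev i₁ < lev a ∧ (lev i₁ = 0 ∨ ∃ e', α i₁ i₁ e' (0, 0, 1) ≠ 0)) ∧
        (lev i₂ < lev a ∧ (lev i₂ = 0 ∨ ∃ e', α i₂ i₂ e' (0, 0, 1) ≠ 0))) ∧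
      (∃ e, α a a e (0, 0, 1) ≠ 0 ∧
        (∀ j, α e e j (0, 0, 1) ≠ 0 → lev j < lev a ∧ (lev j = 0 ∨ ∃ e', α j j e' (0, 0, 1) ≠ 0)) ∧
        (∀ j, j ≠ e → α e e j (0, 0, 0) ≠ 0 →
          lev j < lev a ∧ (lev j = 0 ∨ ∃ e', α j j e' (0, 0, 1) ≠ 0)))) :
    lev 0 = 0 ∨ lev 1 = 0 := by
  by_cases h1 : lev 1 = 0
  · exact Or.inr h1
  · left
    have hsrc : ∃ e, α 1 1 e (0, 0, 1) ≠ 0 := ⟨0, by rw [hw]; simpa using hf⟩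
    obtain ⟨_, h2, _⟩ := hstruct 1 h1 hsrc
    have h001 : α 0 0 1 (0, 0, 0) ≠ 0 := by
      rw [hP 0 1 (by decide)]
      simpa using hP0
    obtain ⟨⟨_, h0alt⟩, _⟩ := h2 0 0 (by decide) (by decide) h001
    rcases h0alt with h00 | ⟨e', he'⟩
    · exact h00
    · exact absurd (by rw [hw]; simp) he'

/-- **PRIMARY GRADED BARRIER ⇒ super-critical barrier for the chain a two-ladder embeds** (ratio `(1+ε₀)^{1/2}`, residue
class `mod 2`): the body of `PrimaryGradedAt R ε₀ α` (verbatim) for a two-ladder with `f ≠ 0`, `P ≠ 0` yields `θ ∈ (1/2,1]`,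
`D ≥ 0` and `j ∈ {0,1}` with the ν-uniform bound `(1+ε₀)^{2θn}·½x_{j,n}(t)² ≤ D·E₀` along every honest non-negative
viscous solution. MODEL lattice bookkeeping; no stub is proved. [this file] -/
theorem twoLadder_chainBarrier_of_primaryGraded {R ε₀ : ℝ}
    (hT : Literature.Analysis.FluidPDE.TaoCascade.InTableClass R α)
    (hO : ∀ (Y : Fin 4 → ℤ → ℝ → ℝ) (τ : ℝ), (∀ (j : Fin 4) (k : ℤ), 1 ≤ k → 0 ≤ Y j k τ) →
      ∀ δ : ℝ, 0 < δ → ∀ (i : Fin 4) (n : ℤ), 1 ≤ n → Y i n τ = 0 → 0 ≤ quadTerm δ α Y i n τ)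
    (hD : ∀ a b i : Fin 4, a ≠ b → α a b i (0, 0, 1) = 0)
    (hw : ∀ a c : Fin 4, α a a c (0, 0, 1) = if a = 1 ∧ c = 0 then f else 0)
    (hP : ∀ a c : Fin 4, a ≠ c → α a a c (0, 0, 0) = if a = 0 ∧ c = 1 then P else 0)
    (hf : f ≠ 0) (hP0 : P ≠ 0)
    (hPG : Literature.Analysis.FluidPDE.TaoCascade.InTableClass R α →
      (∀ (Y : Fin 4 → ℤ → ℝ → ℝ) (τ : ℝ), (∀ (j : Fin 4) (k : ℤ), 1 ≤ k → 0 ≤ Y j k τ) → ∀ δ : ℝ, 0 < δ →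
        ∀ (i : Fin 4) (n : ℤ), 1 ≤ n → Y i n τ = 0 → 0 ≤ Literature.Analysis.FluidPDE.TaoCascade.quadTerm δ α Y i n τ) →
      (∀ a b i : Fin 4, a ≠ b → α a b i (0, 0, 1) = 0) →
      ∃ (lev : Fin 4 → ℕ) (L : ℕ), (∀ a, lev a ≤ L) ∧
        (∀ a, lev a ≠ 0 → (∃ e, α a a e (0, 0, 1) ≠ 0) →
          (∀ j, α j j a (0, 0, 1) ≠ 0 → lev j < lev a ∧ (lev j = 0 ∨ ∃ e', α j j e' (0, 0, 1) ≠ 0)) ∧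
          (∀ i₁ i₂, i₁ ≠ a → i₂ ≠ a → α i₁ i₂ a (0, 0, 0) ≠ 0 →
            (lev i₁ < lev a ∧ (lev i₁ = 0 ∨ ∃ e', α i₁ i₁ e' (0, 0, 1) ≠ 0)) ∧
            (lev i₂ < lev a ∧ (lev i₂ = 0 ∨ ∃ e', α i₂ i₂ e' (0, 0, 1) ≠ 0))) ∧
          (∃ e, α a a e (0, 0, 1) ≠ 0 ∧
            (∀ j, α e e j (0, 0, 1) ≠ 0 → lev j < lev a ∧ (lev j = 0 ∨ ∃ e', α j j e' (0, 0, 1) ≠ 0)) ∧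
            (∀ j, j ≠ e → α e e j (0, 0, 0) ≠ 0 →
              lev j < lev a ∧ (lev j = 0 ∨ ∃ e', α j j e' (0, 0, 1) ≠ 0)))) ∧
        ∃ θ : ℝ, 1 / 2 < θ ∧ θ ≤ 1 ∧ ∃ D : ℝ, 0 ≤ D ∧
          ∀ ν : ℝ, 0 < ν → ∀ (X₀ : Fin 4 → ℝ) (s : ℝ), 0 < s → ∀ X : Fin 4 → ℤ → ℝ → ℝ,
          (∀ (i : Fin 4) (k : ℤ), X i k 0 = if k = 0 then X₀ i else 0) →
          (∀ (i : Fin 4) (k : ℤ), k < 0 → ∀ t : ℝ, X i k t = 0) →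
          (∃ M : ℝ, ∀ (t : ℝ) (i : Fin 4) (k : ℤ), (1 + (1 + ε₀) ^ ((10 : ℝ) * k)) * |X i k t| ≤ M) →
          (∀ (i : Fin 4) (k : ℤ), Continuous (X i k)) →
          (∀ (i : Fin 4) (k : ℤ), ∀ t ∈ Set.Icc (0 : ℝ) s, HasDerivWithinAt (X i k)
            (Literature.Analysis.FluidPDE.TaoCascade.quadTerm ε₀ α X i k t - ν * (1 + ε₀) ^ ((2 : ℝ) * k) * X i k t)
            (Set.Icc (0 : ℝ) s) t) →
          (∀ t ∈ Set.Icc (0 : ℝ) s, ∀ (i : Fin 4) (k : ℤ), 1 ≤ k → 0 ≤ X i k t) →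
          ∀ t ∈ Set.Icc (0 : ℝ) s, ∀ i, lev i = 0 → ∀ k : ℕ,
            (1 + ε₀) ^ (2 * θ * (k : ℝ)) * ((1 / 2 : ℝ) * X i (k : ℤ) t ^ 2) ≤
              D * (∑ j : Fin 4, (1 / 2 : ℝ) * X₀ j ^ 2)) :
    ∃ j : Fin 4, (j = 0 ∨ j = 1) ∧ ∃ θ : ℝ, 1 / 2 < θ ∧ θ ≤ 1 ∧ ∃ D : ℝ, 0 ≤ D ∧
      ∀ ν : ℝ, 0 < ν → ∀ (X₀ : Fin 4 → ℝ) (s : ℝ), 0 < s → ∀ X : Fin 4 → ℤ → ℝ → ℝ,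
      (∀ (i : Fin 4) (k : ℤ), X i k 0 = if k = 0 then X₀ i else 0) →
      (∀ (i : Fin 4) (k : ℤ), k < 0 → ∀ t : ℝ, X i k t = 0) →
      (∃ M : ℝ, ∀ (t : ℝ) (i : Fin 4) (k : ℤ), (1 + (1 + ε₀) ^ ((10 : ℝ) * k)) * |X i k t| ≤ M) →
      (∀ (i : Fin 4) (k : ℤ), Continuous (X i k)) →
      (∀ (i : Fin 4) (k : ℤ), ∀ t ∈ Set.Icc (0 : ℝ) s, HasDerivWithinAt (X i k)
        (Literature.Analysis.FluidPDE.TaoCascade.quadTerm ε₀ α X i k t - ν * (1 + ε₀) ^ ((2 : ℝ) * k) * X i k t)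
        (Set.Icc (0 : ℝ) s) t) →
      (∀ t ∈ Set.Icc (0 : ℝ) s, ∀ (i : Fin 4) (k : ℤ), 1 ≤ k → 0 ≤ X i k t) →
      ∀ t ∈ Set.Icc (0 : ℝ) s, ∀ k : ℕ,
        (1 + ε₀) ^ (2 * θ * (k : ℝ)) * ((1 / 2 : ℝ) * X j (k : ℤ) t ^ 2) ≤
          D * (∑ i : Fin 4, (1 / 2 : ℝ) * X₀ i ^ 2) := by
  obtain ⟨lev, _L, _hL, hstruct, θ, hθ, hθ1, D, hD, H⟩ := hPG hT hO hD
  have h01 := twoLadder_primary_zero_or_one hw hP hf hP0 lev hstruct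
  rcases h01 with h0 | h1
  · refine ⟨0, Or.inl rfl, θ, hθ, hθ1, D, hD, ?_⟩
    intro ν hν X₀ s hs X hX0 hXneg hM hXc hXd hXpos t ht k
    exact H ν hν X₀ s hs X hX0 hXneg hM hXc hXd hXpos t ht 0 h0 k
  · refine ⟨1, Or.inr rfl, θ, hθ, hθ1, D, hD, ?_⟩
    intro ν hν X₀ s hs X hX0 hXneg hM hXc hXd hXpos t ht k
    exact H ν hν X₀ s hs X hX0 hXneg hM hXc hXd hXpos t ht 1 h1 k

end TwoLadder

/-! ## §3 The tuned two-ladder is an admissible table of `E₂(8)` -/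

section TwoLadderW

variable {α : Fin 4 → Fin 4 → Fin 4 → ℤ × ℤ × ℤ → ℝ} {p : ℝ}

/-- Symmetry (4.2) of a two-ladder table given in closed form on the four shifts. [this file] -/
theorem twoLadderW_symmetric
    (hfeed : ∀ i₁ i₂ i₃ : Fin 4, α i₁ i₂ i₃ ((0 : ℤ), (0 : ℤ), (1 : ℤ)) =
      if i₁ = 1 ∧ i₂ = 1 ∧ i₃ = 0 then (1 : ℝ) else 0)
    (hup1 : ∀ i₁ i₂ i₃ : Fin 4, α i₁ i₂ i₃ ((1 : ℤ), (0 : ℤ), (0 : ℤ)) =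
      if i₁ = 0 ∧ i₂ = 1 ∧ i₃ = 1 then (-(1 / 2) : ℝ) else 0)
    (hup2 : ∀ i₁ i₂ i₃ : Fin 4, α i₁ i₂ i₃ ((0 : ℤ), (1 : ℤ), (0 : ℤ)) =
      if i₁ = 1 ∧ i₂ = 0 ∧ i₃ = 1 then (-(1 / 2) : ℝ) else 0)
    (hin : ∀ i₁ i₂ i₃ : Fin 4, α i₁ i₂ i₃ ((0 : ℤ), (0 : ℤ), (0 : ℤ)) =
      (if i₁ = 0 ∧ i₂ = 0 ∧ i₃ = 1 then p else 0) +
        (if (i₁ = 0 ∧ i₂ = 1 ∧ i₃ = 0) ∨ (i₁ = 1 ∧ i₂ = 0 ∧ i₃ = 0) then -p / 2 else 0)) :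
    IsSymmetricCoeff α := by
  intro i₁ i₂ i₃ μ₁ μ₂ μ₃ hμ
  rw [mem_shiftSet_iff] at hμ
  simp only [Prod.mk.injEq] at hμ
  rcases hμ with ⟨rfl, rfl, rfl⟩ | ⟨rfl, rfl, rfl⟩ | ⟨rfl, rfl, rfl⟩ | ⟨rfl, rfl, rfl⟩
  · simp only [hin]
    fin_cases i₁ <;> fin_cases i₂ <;> fin_cases i₃ <;> simp
  · simp only [hup1, hup2]
    fin_cases i₁ <;> fin_cases i₂ <;> fin_cases i₃ <;> simp
  · simp only [hup1, hup2]
    fin_cases i₁ <;> fin_cases i₂ <;> fin_cases i₃ <;> simp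
  · simp only [hfeed]
    fin_cases i₁ <;> fin_cases i₂ <;> fin_cases i₃ <;> simp

/-- Cancellation (4.3) of a two-ladder table. [this file] -/
theorem twoLadderW_cancelling
    (hfeed : ∀ i₁ i₂ i₃ : Fin 4, α i₁ i₂ i₃ ((0 : ℤ), (0 : ℤ), (1 : ℤ)) =
      if i₁ = 1 ∧ i₂ = 1 ∧ i₃ = 0 then (1 : ℝ) else 0)
    (hup1 : ∀ i₁ i₂ i₃ : Fin 4, α i₁ i₂ i₃ ((1 : ℤ), (0 : ℤ), (0 : ℤ)) =
      if i₁ = 0 ∧ i₂ = 1 ∧ i₃ = 1 then (-(1 / 2) : ℝ) else 0)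
    (hup2 : ∀ i₁ i₂ i₃ : Fin 4, α i₁ i₂ i₃ ((0 : ℤ), (1 : ℤ), (0 : ℤ)) =
      if i₁ = 1 ∧ i₂ = 0 ∧ i₃ = 1 then (-(1 / 2) : ℝ) else 0)
    (hin : ∀ i₁ i₂ i₃ : Fin 4, α i₁ i₂ i₃ ((0 : ℤ), (0 : ℤ), (0 : ℤ)) =
      (if i₁ = 0 ∧ i₂ = 0 ∧ i₃ = 1 then p else 0) +
        (if (i₁ = 0 ∧ i₂ = 1 ∧ i₃ = 0) ∨ (i₁ = 1 ∧ i₂ = 0 ∧ i₃ = 0) then -p / 2 else 0)) :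
    IsCancellingCoeff α := by
  intro i₁ i₂ i₃ μ₁ μ₂ μ₃ hμ
  rw [mem_shiftSet_iff] at hμ
  simp only [Prod.mk.injEq] at hμ
  rcases hμ with ⟨rfl, rfl, rfl⟩ | ⟨rfl, rfl, rfl⟩ | ⟨rfl, rfl, rfl⟩ | ⟨rfl, rfl, rfl⟩ <;>
    simp only [hin, hfeed, hup1, hup2] <;>
    fin_cases i₁ <;> fin_cases i₂ <;> fin_cases i₃ <;> simp <;> ring

/-- A two-ladder table with pump weight `p ∈ [1/4, 1]` belongs to `E₂(8)`. [this file] -/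
theorem twoLadderW_inTableClass
    (hfeed : ∀ i₁ i₂ i₃ : Fin 4, α i₁ i₂ i₃ ((0 : ℤ), (0 : ℤ), (1 : ℤ)) =
      if i₁ = 1 ∧ i₂ = 1 ∧ i₃ = 0 then (1 : ℝ) else 0)
    (hup1 : ∀ i₁ i₂ i₃ : Fin 4, α i₁ i₂ i₃ ((1 : ℤ), (0 : ℤ), (0 : ℤ)) =
      if i₁ = 0 ∧ i₂ = 1 ∧ i₃ = 1 then (-(1 / 2) : ℝ) else 0)
    (hup2 : ∀ i₁ i₂ i₃ : Fin 4, α i₁ i₂ i₃ ((0 : ℤ), (1 : ℤ), (0 : ℤ)) =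
      if i₁ = 1 ∧ i₂ = 0 ∧ i₃ = 1 then (-(1 / 2) : ℝ) else 0)
    (hin : ∀ i₁ i₂ i₃ : Fin 4, α i₁ i₂ i₃ ((0 : ℤ), (0 : ℤ), (0 : ℤ)) =
      (if i₁ = 0 ∧ i₂ = 0 ∧ i₃ = 1 then p else 0) +
        (if (i₁ = 0 ∧ i₂ = 1 ∧ i₃ = 0) ∨ (i₁ = 1 ∧ i₂ = 0 ∧ i₃ = 0) then -p / 2 else 0))
    (h0 : 1 / 4 ≤ p ∧ p ≤ 1) :
    Literature.Analysis.FluidPDE.TaoCascade.InTableClass 8 α := by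
  have a0 : |p| = p := abs_of_pos (by linarith [h0.1])
  have e0 : |p| ≤ 1 ∧ (p = 0 ∨ (8 : ℝ)⁻¹ ≤ |p|) := ⟨by rw [a0]; exact h0.2, Or.inr (by rw [a0]; linarith [h0.1])⟩
  have b0 : |-p / 2| = p / 2 := by rw [neg_div, abs_neg, abs_div, a0, abs_two]
  have d0 : |-p / 2| ≤ 1 ∧ (p = 0 ∨ (8 : ℝ)⁻¹ ≤ |-p / 2|) :=
    ⟨by rw [b0]; linarith [h0.2], Or.inr (by rw [b0]; linarith [h0.1])⟩
  have hcmp : IsComparableCoeff 8 α := by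
    intro i₁ i₂ i₃ μ hμ
    rw [mem_shiftSet_iff] at hμ
    rcases hμ with rfl | rfl | rfl | rfl <;>
      simp only [hin, hfeed, hup1, hup2] <;>
      fin_cases i₁ <;> fin_cases i₂ <;> fin_cases i₃ <;> simp <;>
      first | exact e0 | exact d0 | norm_num
  exact ⟨twoLadderW_symmetric hfeed hup1 hup2 hin, twoLadderW_cancelling hfeed hup1 hup2 hin, hcmp⟩

/-- The orthant (Kamke) hypothesis for a two-ladder table with `p ≥ 0`, via `orthant_iff_coefficients`. [this file] -/
theorem twoLadderW_orthant
    (hfeed : ∀ i₁ i₂ i₃ : Fin 4, α i₁ i₂ i₃ ((0 : ℤ), (0 : ℤ), (1 : ℤ)) =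
      if i₁ = 1 ∧ i₂ = 1 ∧ i₃ = 0 then (1 : ℝ) else 0)
    (hup1 : ∀ i₁ i₂ i₃ : Fin 4, α i₁ i₂ i₃ ((1 : ℤ), (0 : ℤ), (0 : ℤ)) =
      if i₁ = 0 ∧ i₂ = 1 ∧ i₃ = 1 then (-(1 / 2) : ℝ) else 0)
    (hup2 : ∀ i₁ i₂ i₃ : Fin 4, α i₁ i₂ i₃ ((0 : ℤ), (1 : ℤ), (0 : ℤ)) =
      if i₁ = 1 ∧ i₂ = 0 ∧ i₃ = 1 then (-(1 / 2) : ℝ) else 0)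
    (hin : ∀ i₁ i₂ i₃ : Fin 4, α i₁ i₂ i₃ ((0 : ℤ), (0 : ℤ), (0 : ℤ)) =
      (if i₁ = 0 ∧ i₂ = 0 ∧ i₃ = 1 then p else 0) +
        (if (i₁ = 0 ∧ i₂ = 1 ∧ i₃ = 0) ∨ (i₁ = 1 ∧ i₂ = 0 ∧ i₃ = 0) then -p / 2 else 0))
    (h0 : 0 ≤ p) :
    ∀ (Y : Fin 4 → ℤ → ℝ → ℝ) (τ : ℝ), (∀ (j : Fin 4) (k : ℤ), 1 ≤ k → 0 ≤ Y j k τ) →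
      ∀ δ : ℝ, 0 < δ → ∀ (i : Fin 4) (n : ℤ), 1 ≤ n → Y i n τ = 0 → 0 ≤ quadTerm δ α Y i n τ := by
  rw [orthant_iff_coefficients]
  refine ⟨?_, ?_, ?_⟩
  · intro i w
    simp only [hfeed, Fin.sum_univ_four]
    fin_cases i <;> simp
    nlinarith [mul_self_nonneg (w 1)]
  · intro i a b hbi
    simp only [hup1, hup2]
    fin_cases i <;> fin_cases a <;> fin_cases b <;> simp at hbi ⊢
  · intro i y hy hyi
    simp only [hin, Fin.sum_univ_four]
    fin_cases i <;> simp at hyi ⊢ <;>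
      nlinarith [mul_nonneg h0 (mul_self_nonneg (y 0)), mul_eq_zero_of_left hyi (p * y 1)]

/-- The structural hypotheses of the two-ladder class: diagonal feeds, `hw` with `f = 1`, `hP` with weight `p`, no differential
triads. [this file] -/
theorem twoLadderW_struct
    (hfeed : ∀ i₁ i₂ i₃ : Fin 4, α i₁ i₂ i₃ ((0 : ℤ), (0 : ℤ), (1 : ℤ)) =
      if i₁ = 1 ∧ i₂ = 1 ∧ i₃ = 0 then (1 : ℝ) else 0)
    (hin : ∀ i₁ i₂ i₃ : Fin 4, α i₁ i₂ i₃ ((0 : ℤ), (0 : ℤ), (0 : ℤ)) =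
      (if i₁ = 0 ∧ i₂ = 0 ∧ i₃ = 1 then p else 0) +
        (if (i₁ = 0 ∧ i₂ = 1 ∧ i₃ = 0) ∨ (i₁ = 1 ∧ i₂ = 0 ∧ i₃ = 0) then -p / 2 else 0)) :
    (∀ a b i : Fin 4, a ≠ b → α a b i (0, 0, 1) = 0) ∧
    (∀ a c : Fin 4, α a a c (0, 0, 1) = if a = 1 ∧ c = 0 then (1 : ℝ) else 0) ∧
    (∀ a c : Fin 4, a ≠ c → α a a c (0, 0, 0) = if a = 0 ∧ c = 1 then p else 0) ∧
    (∀ a b c : Fin 4, a ≠ b → a ≠ c → b ≠ c → α a b c (0, 0, 0) = 0) := by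
  refine ⟨?_, ?_, ?_, ?_⟩
  · intro a b i hab
    rw [hfeed]
    fin_cases a <;> fin_cases b <;> simp at hab ⊢
  · intro a c
    rw [hfeed]
    fin_cases a <;> fin_cases c <;> simp
  · intro a c hac
    rw [hin]
    fin_cases a <;> fin_cases c <;> simp at hac ⊢
  · intro a b c hab hac hbc
    rw [hin]
    fin_cases a <;> fin_cases b <;> fin_cases c <;> simp at hab hac hbc ⊢

end TwoLadderW

/-- **THE TUNED TWO-LADDER EXISTS INSIDE THE CRUX'S HYPOTHESES AT EVERY SCALE RATIO**: for every `ε₀ ∈ (0, 1]` there is a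
table of `E₂(8)`, orthant with diagonal feeds, with exactly the two-ladder couplings — pump `0→1` of weight
`P = (1+ε₀)^{-5/4}`, forward feed `1→0` of weight `1`, no differential triads — and the tuning identities
`P·Λₙ = c·B^{5(2n)/2}`, `1·Λₙ = c·B^{5(2n+1)/2}` (`c = (1+ε₀)^{-5/4}`, `B = (1+ε₀)^{1/2}`). [this file] -/
theorem twoLadder_nonempty {ε₀ : ℝ} (hε : 0 < ε₀) (hε1 : ε₀ ≤ 1) :
    ∃ α : Fin 4 → Fin 4 → Fin 4 → ℤ × ℤ × ℤ → ℝ, ∃ P : ℝ,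
    Literature.Analysis.FluidPDE.TaoCascade.InTableClass 8 α ∧
    (∀ (Y : Fin 4 → ℤ → ℝ → ℝ) (τ : ℝ), (∀ (j : Fin 4) (k : ℤ), 1 ≤ k → 0 ≤ Y j k τ) →
      ∀ δ : ℝ, 0 < δ → ∀ (i : Fin 4) (n : ℤ), 1 ≤ n → Y i n τ = 0 → 0 ≤ quadTerm δ α Y i n τ) ∧
    (∀ a b i : Fin 4, a ≠ b → α a b i (0, 0, 1) = 0) ∧
    (∀ a c : Fin 4, α a a c (0, 0, 1) = if a = 1 ∧ c = 0 then (1 : ℝ) else 0) ∧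
    (∀ a c : Fin 4, a ≠ c → α a a c (0, 0, 0) = if a = 0 ∧ c = 1 then P else 0) ∧
    (∀ a b c : Fin 4, a ≠ b → a ≠ c → b ≠ c → α a b c (0, 0, 0) = 0) ∧
    0 < P ∧
    (∀ n : ℤ, P * (1 + ε₀) ^ ((5 : ℝ) * n / 2) =
      (1 + ε₀) ^ (-((5 : ℝ) / 4)) * ((1 + ε₀) ^ ((1 : ℝ) / 2)) ^ ((5 : ℝ) * ((2 * n : ℤ) : ℝ) / 2)) ∧
    (∀ n : ℤ, (1 : ℝ) * (1 + ε₀) ^ ((5 : ℝ) * n / 2) =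
      (1 + ε₀) ^ (-((5 : ℝ) / 4)) * ((1 + ε₀) ^ ((1 : ℝ) / 2)) ^ ((5 : ℝ) * ((2 * n + 1 : ℤ) : ℝ) / 2)) := by
  have hb0 : (0 : ℝ) < 1 + ε₀ := by linarith
  have hb1 : (1 : ℝ) ≤ 1 + ε₀ := by linarith
  have hb2 : 1 + ε₀ ≤ 2 := by linarith
  set p : ℝ := (1 + ε₀) ^ (-((5 : ℝ) / 4)) with hp
  have w0 : 1 / 4 ≤ p ∧ p ≤ 1 := by
    constructor
    · rw [hp, Real.rpow_neg hb0.le]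
      have hle : (1 + ε₀) ^ ((5 : ℝ) / 4) ≤ 4 := by
        calc (1 + ε₀) ^ ((5 : ℝ) / 4) ≤ (2 : ℝ) ^ ((5 : ℝ) / 4) := Real.rpow_le_rpow hb0.le hb2 (by norm_num)
          _ ≤ (2 : ℝ) ^ ((2 : ℕ) : ℝ) := Real.rpow_le_rpow_of_exponent_le (by norm_num) (by norm_num)
          _ = 4 := by rw [Real.rpow_natCast]; norm_num
      have hpos : 0 < (1 + ε₀) ^ ((5 : ℝ) / 4) := Real.rpow_pos_of_pos hb0 _
      calc (1 : ℝ) / 4 = 4⁻¹ := by norm_num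
        _ ≤ ((1 + ε₀) ^ ((5 : ℝ) / 4))⁻¹ := inv_anti₀ hpos hle
    · exact Real.rpow_le_one_of_one_le_of_nonpos hb1 (by norm_num)
  set α : Fin 4 → Fin 4 → Fin 4 → ℤ × ℤ × ℤ → ℝ := fun i₁ i₂ i₃ μ =>
    if μ = ((0 : ℤ), (0 : ℤ), (1 : ℤ)) then (if i₁ = 1 ∧ i₂ = 1 ∧ i₃ = 0 then (1 : ℝ) else 0)
    else if μ = ((1 : ℤ), (0 : ℤ), (0 : ℤ)) then (if i₁ = 0 ∧ i₂ = 1 ∧ i₃ = 1 then (-(1 / 2) : ℝ) else 0)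
    else if μ = ((0 : ℤ), (1 : ℤ), (0 : ℤ)) then (if i₁ = 1 ∧ i₂ = 0 ∧ i₃ = 1 then (-(1 / 2) : ℝ) else 0)
    else if μ = ((0 : ℤ), (0 : ℤ), (0 : ℤ)) then
      ((if i₁ = 0 ∧ i₂ = 0 ∧ i₃ = 1 then p else 0) +
        (if (i₁ = 0 ∧ i₂ = 1 ∧ i₃ = 0) ∨ (i₁ = 1 ∧ i₂ = 0 ∧ i₃ = 0) then -p / 2 else 0))
    else 0 with hα
  have hfeed : ∀ i₁ i₂ i₃ : Fin 4, α i₁ i₂ i₃ ((0 : ℤ), (0 : ℤ), (1 : ℤ)) =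
      if i₁ = 1 ∧ i₂ = 1 ∧ i₃ = 0 then (1 : ℝ) else 0 := by
    intro i₁ i₂ i₃; simp [hα]
  have hup1 : ∀ i₁ i₂ i₃ : Fin 4, α i₁ i₂ i₃ ((1 : ℤ), (0 : ℤ), (0 : ℤ)) =
      if i₁ = 0 ∧ i₂ = 1 ∧ i₃ = 1 then (-(1 / 2) : ℝ) else 0 := by
    intro i₁ i₂ i₃; simp [hα]
  have hup2 : ∀ i₁ i₂ i₃ : Fin 4, α i₁ i₂ i₃ ((0 : ℤ), (1 : ℤ), (0 : ℤ)) =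
      if i₁ = 1 ∧ i₂ = 0 ∧ i₃ = 1 then (-(1 / 2) : ℝ) else 0 := by
    intro i₁ i₂ i₃; simp [hα]
  have hin : ∀ i₁ i₂ i₃ : Fin 4, α i₁ i₂ i₃ ((0 : ℤ), (0 : ℤ), (0 : ℤ)) =
      (if i₁ = 0 ∧ i₂ = 0 ∧ i₃ = 1 then p else 0) +
        (if (i₁ = 0 ∧ i₂ = 1 ∧ i₃ = 0) ∨ (i₁ = 1 ∧ i₂ = 0 ∧ i₃ = 0) then -p / 2 else 0) := by
    intro i₁ i₂ i₃; simp [hα]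
  have key : ∀ (a e : ℝ), a + (5 : ℝ) / 4 = e / 2 →
      (1 + ε₀) ^ a = (1 + ε₀) ^ (-((5 : ℝ) / 4)) * ((1 + ε₀) ^ ((1 : ℝ) / 2)) ^ e := by
    intro a e h
    rw [← Real.rpow_mul hb0.le, ← Real.rpow_add hb0]
    congr 1
    linarith
  obtain ⟨hdiag, hw, hP, hCz⟩ := twoLadderW_struct hfeed hin
  refine ⟨α, p, twoLadderW_inTableClass hfeed hup1 hup2 hin w0,
    twoLadderW_orthant hfeed hup1 hup2 hin (by linarith [w0.1]), hdiag, hw, hP, hCz,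
    Real.rpow_pos_of_pos hb0 _, ?_, ?_⟩
  · intro n
    rw [hp, ← Real.rpow_add hb0]
    exact key _ _ (by push_cast; ring)
  · intro n
    rw [one_mul]
    exact key _ _ (by push_cast; ring)

end Summit.NavierStokesRegularity.NavierStokesRegularity.Theorems

end
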